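import Summits.QuantumFields.GaugeBoot.Rung0D3Canon
import HarnessLib

/-!
# Gauge-boot rung-0 truncation, `D = 3`, `SU(2)`: the torus variables and their feasibility

Cell `pub-gaugeboot`, seat lean1, FANOUT-PLAN A26(b,c). Companion of `Rung0D3Words.lean`.

HONEST FRAMING (page 1 of every file of this cell): certified bounds on lattice expectations at STATED coupling, gauge
group, dimension and torus size; NOT a mass gap, NOT a continuum limit, NOT a string tension, NOT large `N`; NOT
Yang–Mills-summit-bearing (barriers `FixedCouplingUltralocality`, `PerturbativeInvisibility`).

For every standard coupling `β` (tree coupling `β/2`) and every torus `(ℤ/L)^3`: the variables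
`y β L v = ⟨W_0(rep v)⟩` are torus Wilson-loop expectations; `y β L 0 = 1`; `|y β L v| ≤ 1` (`WordLoop`); every Gram
entry is a variable (`gram_entry`, from `canon_table` and `LoopClasses.wilsonExpectation_wordLoop_canon`); the
quadratic form `∑ᵢⱼ cᵢ cⱼ y (cls i j)` is non-negative (`WordLoop.sum_mul_wilsonExpectation_wordLoop_nonneg`) and
hence ANY real matrix with entries `y (cls i j)` is positive semidefinite (`posSemidef_of_apply_eq` — the form in
which the certificate files `Certificates/R0D3*.lean` of seat lean3 take their hypothesis, via their
`gramBlock_apply`); and `plaquetteExpectation 2 3 L β = y β L 1`. The loop-equation rows are NOT here (they are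
hypotheses of the per-row bindings until task L1 lands them).
-/

noncomputable section

open MeasureTheory Matrix
open Literature.MathematicalPhysics.QuantumFieldTheory

namespace Summit.QuantumFields.GaugeBoot

namespace Rung0D3

variable (β : ℝ) (L : ℕ) [NeZero L]

/-- `W β L w = ⟨W_0(w)⟩_{(ℤ/L)^3, SU(2), β}` (tree coupling `β/2`). -/
def W (w : Word 3) : ℝ :=
  wilsonExpectation (suRep 2) (β / (2 : ℕ)) (wordLoop (suRep 2) (0 : Site 3 L) w)

/-- The variables `y v = ⟨W_0(rep v)⟩`. -/
def y (v : Fin 11) : ℝ := W β L (rep v)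

/-- `y 0 = ⟨W(∅)⟩ = 1`. -/
theorem y_zero : y β L 0 = 1 := by
  haveI := isProbabilityMeasure_wilsonMeasure (d := 3) (L := L) (G := SU 2) (suRep 2) (continuous_suRep 2)
    (β / (2 : ℕ))
  show wilsonExpectation (suRep 2) (β / (2 : ℕ)) (wordLoop (suRep 2) (0 : Site 3 L) ([] : Word 3)) = 1
  rw [wordLoop_nil (suRep 2) (by norm_num) 0]
  simp [wilsonExpectation]

/-- `|y v| ≤ 1`. -/
theorem abs_y_le_one (v : Fin 11) : |y β L v| ≤ 1 :=
  abs_wilsonExpectation_wordLoop_le_one (suRep 2) (continuous_suRep 2) _ 0 (rep v)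

/-- **Every Gram entry is a variable**: `⟨W_0(Oᵢ⁻¹ Oⱼ)⟩ = y (cls i j)`. -/
theorem gram_entry (i j : Fin 25) : W β L (Word.reverse (O i) ++ O j) = y β L (cls i j) := by
  obtain ⟨hd, hc⟩ := canon_table i j
  unfold y W
  rw [← hc]
  exact wilsonExpectation_wordLoop_canon (suRep 2) (continuous_suRep 2) _ _ _ _ _ _ hd

/-- **Gram positivity in the variables**: `0 ≤ ∑ᵢⱼ cᵢ cⱼ y (cls i j)` for all real `c`. -/
theorem gram_nonneg (c : Fin 25 → ℝ) : 0 ≤ ∑ i, ∑ j, c i * c j * y β L (cls i j) := by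
  have h := sum_mul_wilsonExpectation_wordLoop_nonneg (suRep 2) (continuous_suRep 2) (β / (2 : ℕ))
    (0 : Site 3 L) O (fun i => Word.endpoint_eq_self_of_disp 0 (disp_O i)) c
  have h' : ∀ i j : Fin 25, wilsonExpectation (suRep 2) (β / (2 : ℕ))
      (wordLoop (suRep 2) (0 : Site 3 L) (Word.reverse (O i) ++ O j)) = y β L (cls i j) := fun i j => gram_entry β L i j
  simp only [h'] at h
  exact h

/-- **Any real matrix whose entries are the class variables is positive semidefinite** — the hypothesis shape
`(gramBlock y).PosSemidef` of the certificate files, through their `gramBlock_apply`. -/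
theorem posSemidef_of_apply_eq (B : Matrix (Fin 25) (Fin 25) ℝ) (hB : ∀ i j, B i j = y β L (cls i j)) :
    B.PosSemidef := by
  refine PosSemidef.of_dotProduct_mulVec_nonneg ?_ fun x => ?_
  · ext i j
    simp only [conjTranspose_apply, star_trivial, hB, cls_symm]
  · have h := gram_nonneg β L x
    simp only [dotProduct, mulVec, star_trivial, hB, Finset.mul_sum] at h ⊢
    refine h.trans_eq (Finset.sum_congr rfl fun i _ => Finset.sum_congr rfl fun j _ => by ring)

/-- The tree's plaquette expectation is the objective variable. -/
theorem plaquetteExpectation_eq : plaquetteExpectation 2 3 L β = y β L 1 := by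
  unfold plaquetteExpectation y W
  rw [wilsonExpectation_meanPlaquette_eq_plaquetteTrace (suRep 2) (continuous_suRep 2) _ (0 : Site 3 L)
    (show (0 : Fin 3) ≠ 1 by decide), ← wordLoop_plaquette,
    wilsonExpectation_wordLoop_canon (suRep 2) (continuous_suRep 2) _ _ _ _ _ _ canon_plaquette.1, canon_plaquette.2]

end Rung0D3

end Summit.QuantumFields.GaugeBoot

end
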